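import Summits.QuantumFields.YangMills.Theorems.BalabanUVNodesK0RecordFormatNamesP0C
import Literature.MathematicalPhysics.QuantumFieldTheory.Balaban1983to89.B13EntrywiseWalks
import Literature.MathematicalPhysics.QuantumFieldTheory.Balaban1983to89.Node00.CarriersB13DecoratedTower
import Literature.MathematicalPhysics.QuantumFieldTheory.Balaban1983to89.TreeLengthTorusGeometry

/-!
# K0 ⟷ N10 — THE P0-ℂ CARRIER READ ON A TERM WINDOW: block pins π2∕π1∕A2, the σ-decorated kernel under the entrywise model, the
# cube-animal constant of record with its DISPLAYED rate row, the two dictionary letters, and the BRIDGE `B` as ONE `Prop`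

Cell `pub-ymgap` (Track A), seat `pub-ymgap-node00-def-Y` (gen 41, definer∕planner; custodian of the `OpsY`∕`BgScheme` instance of record and of the
`P0FamilySupply` construction).  Commission: ★★★ director-ym №640 (2) (a)(b) (nodeO STATUS 2026-08-31 l.6192); memo of record ◇ lens-1 g16
`LENS-1-NODE-v22-S3-KERNEL-SIDE-IS-P0C.md` (sha16 3f8a18889131d17b) §2 (a)–(d), §10.  Filing lane (dag-lead DEDUP): `--kind definition --supports
stmt-QuantumFields-27930 --as helper`; count-neutral.  [I] = [Balaban1987RG1], [II] = [Balaban1988RG2Cluster], [13] = [Balaban1985BackgroundPropagators].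

WHAT IS PINNED (object identities between ▶ PT-A-1's P0-ℂ letter `K0RecordFormatNames.P0CarrierClauses … TC TY TZY AdM AdZ` and the N10 junction of record
`BalabanUVNodes.N10AtRecord11B13WalksBlockEntrywise.b13LeafOfRecord_of_located_entrywise`, binder blocks (3)∕(3″)).
* §1 (π-win, π2, π1, A2)  `tcWindow T κ` = the carrier `T = TC n φ : FluctIdx → FluctIdx → ℂ` READ ON AN INDEX WINDOW `κ : q → FluctIdx`; on a conditioned window
  `κ : Λ ⊕ C₀ → FluctIdx` (interior `Z₀`-bonds `inl`, exterior `Z₀ᶜ`-bonds `inr`, [II] (2.5) p.12) its blocks are the three kernel slots of `B13ConditioningBlockWalks`: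
  the P-carrier `pBlockOfTC` (= `K`, full precision on `Λ ⊕ C₀`), `a2BlockOfTC = K.toBlocks₁₁` (term precision on `Λ`), the L-carrier
  `lBlockOfTC = fromCols 0 K.toBlocks₁₂` on `Λ × (Λ ⊕ C₀)` (the local factor `Z₀(C*Δ_kC)Z₀ᶜ`, zero-padded) — DEFINITIONS with `rfl` faces; at general `σ` the same
  blocks of `KK Z t σ u` are module 32's `hKA2`∕`hKG2` right-hand sides (`a2OfKK`, `lOfKK`).
* §1 (π-Δ₀)  `deltaOfTC T cfg κ : E → Matrix q q ℂ` — module 32's σ-free operator `Δ₀ Z t` UNDER THE PIN OF RECORD (E) «`Δ₀ Z t` = `TC n` read on the term window»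
  (memo §2 (a)), along a complex chart `cfg : E → Sect2.CPair` of the window's configurations; the σ-decorated kernel is then the lane's OWN
  ✓`Node00.decoratedOp Δ₀ J C` (`CarriersB13DecoratedTower`: module 32's `hKK` right-hand side as a definition, the `ResidB13D` record format) at `C := 1`
  — `decoratedOp_cm_one` (no sandwich), `cm_one_abs_le`, `cm_one_supp` discharge `hKK`'s sandwich and the letters `hCle`, `hCsupp` for `C := 1` (so under (E)
  the lane's `P Z t` is the window itself and `locF = locN`, exactly as the lane's model towers `Node00.CarriersB13BondTower` take `P := Λ ⊕ C₀`, `C := 1`).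
* §1b (π-C)  the averaging∕elimination operator's RECORD NAME: `recordPreckLoc_eq_sandwich` displays DEF-1's `recordPreckLoc = (recordCopLoc)ᵀ·recordSkBlk·recordCopLoc`
  (print's `C*Δ^{(k)}C` with `C = recordCopLoc` ∕ `recordCopFluct` ∕ `recordCopκ`, `Δ^{(k)} = recordSkBlk`), by `rfl`.
* §2 (π-anim)  THE CUBE-ANIMAL CONSTANT OF RECORD in the tree's currency: `animRate := kappa₀ (4·2⁴) (2·4)` (= `64·log 162`, ✓`TreeLengthCubeSystem.kappa₀_four`;
  memo's «`log C_anim`») and `animConst := K₀ (4·2⁴) (2·4)` (memo's «`C_anim`»), with the PROVED family sum `ineq126_recordDomSys`: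
  `Σ_{Y ∈ 𝐃_{k+1}(T_K), Y ∋ □} exp(−animRate·d_{k+1}(Y)) ≤ animConst` for the record's catalogue `recordDomSys F Mc k K` (= ✓`TreeLengthTorusGeometry.tgeometry`'s
  (1.26) field at `d = 4`, by `rfl` transport); the DISPLAYED NUMBER ROW `AnimalRateRow δ₀ := animRate < δ₀` (memo §2 (d): def-Y's keep∕kill demand on (P4)'s
  rate — `δ₀` is DEMANDED in `P0HolExtAtRecord`'s (Q-ord) prefix, so the consumer instantiates `δ₀ > 64·log 162`; print puts the rate in the cube size, [II] p.8
  (1.26) «for κ sufficiently large», [I] p.263 after (1.18)); the porter's constants `entryRate δ₀ cD := (δ₀ − animRate)∕cD`, `entryConst c₀ ρ cS := c₀·animConst·e^{ρ·cS}`.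
* §3 (π-dist, R-dom)  the two DICTIONARY LETTERS of memo §2 (b) as named `Prop`s (displayed, asserted for nothing): `DistDominated` — two window indices whose
  sites lie in a common `Y ∈ 𝐃_{k+1}` are within `cD·d_{k+1}(Y)` in the site-torus distance `tdist1` of the lane's location map; `ChartInRecordSpace` — the
  chart is ℂ-differentiable on the `R`-ball and lands in the record space `recordUc … Y` of every `Y` meeting the window at a pair.
* §4 ★ `P0ToEntryLettersBridge` (B-decay), ★ `P0ToRefAccBridge` (B-acc), ★★ `P0ToN10KernelBridge := B-decay ∧ B-acc` — THE BRIDGE `B` OF THE NODE (memo §3) AS ONE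
  `Prop` (letter convention (H)): «`P0CarrierClauses` at `TC` ⟹ module 32's (3″) letters at `Δ₀ := TC∣window`», namely (P4) Schur rows + (1.26) ⟹
  `RawEntryLetters (deltaOfTC (TC n) cfg κ) loc R (entryRate δ₀ cD) (entryConst c₀ (entryRate δ₀ cD) cS)` under `AnimalRateRow δ₀` and the two dictionary letters
  (memo §2 (b): `‖TC_{bb′}‖ ≤ Σ_{Y ∋ b,b′} ‖T_Y,bb′‖ ≤ Σ_{Y ∋ b,b′} c₀e^{−δ₀d(Y)} ≤ c₀·animConst·e^{entryRate·cS}·e^{−entryRate·d₁(b,b′)}`), and (P5ᶜ) ⟹ `γ₀`-accretivity of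
  the lane's `decoratedOp (deltaOfTC …) J 1 0 0` when the undecorated pairs are exactly the same-component pairs and the reference configuration `cfg 0` lies in the
  record space of a reference domain carrying the window (memo §2 (c); principal compressions of a coercive form are coercive, `Re⟨v, ½(T+Tᵀ)v⟩ =
  ½Re Q(v) + ½Re Q(v̄)`).  STATEMENTS ONLY — the proofs (memo §2 (b)(c) + `rfl`s) are a porter's file.

THE LEVEL PIN, SAID (for ★★★ ∕ ★★ dag-lead ∕ ◇ lens-1; nothing below depends on the ruling).  (E) = memo §2 (a) of record: `Δ₀ := TC∣window`, lane `C := 1`.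
(F) = DEF-1's factorisation of the SAME carrier at real points, (P2): `TC n (recordPairJ … B)∣NonB0 = recordPreckLoc … = (recordCopLoc …)ᵀ · recordSkBlk … · recordCopLoc …`
(✓`K0RecordFormatNames.recordPreckLoc`, ed.15e) — print's `C*Δ^{(k)}C` ([I] p.268) with THE AVERAGING∕ELIMINATION OPERATOR OF RECORD `C` = ✓`recordCopLoc F k K Vk :
Matrix (CoarseIdx ⊕ NonB0Idx) NonB0Idx ℝ` (block rows; = ✓`recordCopFluct F k K Vk : Matrix (FluctIdx F k K) (NonB0Idx F k K) ℝ` re-rowed on `FluctIdx`, ed.15g, the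
push-forward matrix `recordCopκ` of ✓`recordFluctMeasure`) and the FINE precision `Δ^{(k)}` = ✓`recordSkBlk`∕`recordSk₁` (ed.15c).  Under (F) module 32's `C Z t` ↦
`recordCopFluct∣window`, `P Z t` ↦ the fine `FluctIdx`-window, `Δ₀ Z t` ↦ the complex-analytic continuation of `recordSk₁ ∘ portVkAx` (NOT one of P0's five carriers
today) and `TC∣window = KK Z t 1 u` (full coupling).  Both readings inhabit module 32's binder SHAPES; which one NODE 00's (2.14)-identity wants is print's
`Γ_k(Z₀,σ) = C*Δ_k(σ(Z))CZ₀ᶜ(C^{(k)})^{1/2}(σ(Z))` ([II] p.15) read through the tree's ENTRYWISE decoration model (module 32 (3″)) — a ruling, not a theorem.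

HONEST FRAMING.  Definitions, `rfl`∕one-line faces, four `C := 1` bookkeeping lemmas and ONE transported tree inequality (`ineq126_recordDomSys`); the ★ `Prop`s are
DISPLAYED STATEMENTS — asserted for nothing, inhabited nowhere today; NOTHING of [I] (2.11)–(2.14), [II] (2.5)–(2.14), [13] Thm 3.10 is proved or ported here;
`P0HolExtAtRecord` ∕ `stub_P0C` ∕ `stub_FE` ∕ ⟨27930⟩ OPEN; K0ᴬ ∕ K1ᴬ ∕ K3ᴬ OPEN; NODE O 0∕1; COUNT 8∕28 · K 1∕4 UNMOVED; finite `𝕋⁴_{L^K}` at fixed ε — NOT continuum ∕ ℝ⁴ ∕ OS;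
**the Yang–Mills mass gap (Clay) is NOT proved by any of this.**  No `sorry`, `instance`, `notation`; standard axioms.
-/

noncomputable section

open scoped BigOperators

namespace Summit.QuantumFields.YangMills.Theorems.K0P0CarrierPins

open Literature.MathematicalPhysics.QuantumFieldTheory.Balaban1983to89
open Literature.MathematicalPhysics.QuantumFieldTheory.Balaban1983to89.Node00
open Literature.MathematicalPhysics.QuantumFieldTheory.Balaban1983to89.T4Continuum (T4Family)
open B13EntrywiseWalks (RawEntryLetters rawEntryTerm)
open B13Eq111SDecoupling (sDecorate)
open B9Thm37GlueTorus (tdist1)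
open B5TorusCover (UT)
open TreeLengthTorus (TPt)
open B12TreeDecay (kappa₀ K₀)
open Summit.QuantumFields.YangMills.Theorems.K0RecordFormatNames
open _root_.Matrix

/-! ## §1  The carrier on a window: π2 (P-carrier), A2, π1 (L-carrier); `Δ₀ := TC∣window`; the entrywise-decorated kernel with `C := 1` -/

section Window

variable {ι₀ : Type*} {q Λ C₀ : Type}

/-- (π-win) **`TC n φ` READ ON AN INDEX WINDOW** `κ : q → FluctIdx …`: the `q × q` matrix `(a,b) ↦ T (κ a) (κ b)`. [cite: Balaban1988RG2Cluster, (2.5) p.12 (bookkeeping)] -/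
def tcWindow (T : ι₀ → ι₀ → ℂ) (κ : q → ι₀) : Matrix q q ℂ :=
  Matrix.of fun a b => T (κ a) (κ b)

/-- Entry of the window restriction. [folklore] -/
@[simp] theorem tcWindow_apply (T : ι₀ → ι₀ → ℂ) (κ : q → ι₀) (a b : q) : tcWindow T κ a b = T (κ a) (κ b) := rfl

/-- (π2) **THE P-CARRIER** — the full precision `P = K = C*Δ_kC` on the term's bond set `Λ ⊕ C₀` (`(C^{(k)})^{1/2}(σ) = P^{−1/2}`): the carrier read on the conditioned
window. [cite: Balaban1988RG2Cluster, (2.5)–(2.6) pp.12–13] -/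
def pBlockOfTC (T : ι₀ → ι₀ → ℂ) (κ : Λ ⊕ C₀ → ι₀) : Matrix (Λ ⊕ C₀) (Λ ⊕ C₀) ℂ :=
  tcWindow T κ

/-- (A2) **THE TERM PRECISION** `A(σ,u) = Δ^{(k)}(Z₀, …)` = the interior block `K.toBlocks₁₁` on `Λ`. [cite: Balaban1988RG2Cluster, (2.5) p.12] -/
def a2BlockOfTC (T : ι₀ → ι₀ → ℂ) (κ : Λ ⊕ C₀ → ι₀) : Matrix Λ Λ ℂ :=
  (tcWindow T κ).toBlocks₁₁

/-- (π1) **THE L-CARRIER** — the Γ-kernel's local factor `L = Z₀(C*Δ_k(σ)C)Z₀ᶜ` on `Λ × (Λ ⊕ C₀)`: the off-diagonal block `K.toBlocks₁₂`, zero-padded on the interior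
columns (`B13ConditioningBlockWalks`' reading `L = fromCols 0 K.toBlocks₁₂`). [cite: Balaban1988RG2Cluster, (2.14) p.15 («Γ_k(Z₀,σ(Z)) = C*Δ_k(σ(Z))CZ₀ᶜ(C^{(k)})^{1/2}»)] -/
def lBlockOfTC (T : ι₀ → ι₀ → ℂ) (κ : Λ ⊕ C₀ → ι₀) : Matrix Λ (Λ ⊕ C₀) ℂ :=
  Matrix.fromCols (0 : Matrix Λ Λ ℂ) (tcWindow T κ).toBlocks₁₂

/-- The P-carrier's entries. [folklore] -/
@[simp] theorem pBlockOfTC_apply (T : ι₀ → ι₀ → ℂ) (κ : Λ ⊕ C₀ → ι₀) (i j : Λ ⊕ C₀) : pBlockOfTC T κ i j = T (κ i) (κ j) := rfl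

/-- `A2` is the interior block of `P`. [folklore] -/
theorem a2BlockOfTC_eq (T : ι₀ → ι₀ → ℂ) (κ : Λ ⊕ C₀ → ι₀) : a2BlockOfTC T κ = (pBlockOfTC T κ).toBlocks₁₁ := rfl

/-- `A2`'s entries. [folklore] -/
@[simp] theorem a2BlockOfTC_apply (T : ι₀ → ι₀ → ℂ) (κ : Λ ⊕ C₀ → ι₀) (a b : Λ) :
    a2BlockOfTC T κ a b = T (κ (Sum.inl a)) (κ (Sum.inl b)) := rfl

/-- `L` is the zero-padded off-diagonal block of `P`. [folklore] -/
theorem lBlockOfTC_eq (T : ι₀ → ι₀ → ℂ) (κ : Λ ⊕ C₀ → ι₀) :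
    lBlockOfTC T κ = Matrix.fromCols (0 : Matrix Λ Λ ℂ) (pBlockOfTC T κ).toBlocks₁₂ := rfl

/-- `L` vanishes on the interior columns. [folklore] -/
@[simp] theorem lBlockOfTC_apply_inl (T : ι₀ → ι₀ → ℂ) (κ : Λ ⊕ C₀ → ι₀) (a b : Λ) : lBlockOfTC T κ a (Sum.inl b) = 0 := rfl

/-- `L` on the exterior columns is the carrier's interior–exterior entry. [folklore] -/
@[simp] theorem lBlockOfTC_apply_inr (T : ι₀ → ι₀ → ℂ) (κ : Λ ⊕ C₀ → ι₀) (a : Λ) (c : C₀) :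
    lBlockOfTC T κ a (Sum.inr c) = T (κ (Sum.inl a)) (κ (Sum.inr c)) := rfl

/-- At general `σ`: the `A2`-slot of a kernel `KK` on `Λ ⊕ C₀` (module 32's `hKA2` right-hand side). [cite: Balaban1988RG2Cluster, (2.5) p.12] -/
def a2OfKK {S E : Type*} (KK : S → E → Matrix (Λ ⊕ C₀) (Λ ⊕ C₀) ℂ) (σ : S) (u : E) : Matrix Λ Λ ℂ :=
  (KK σ u).toBlocks₁₁

/-- At general `σ`: the `L`-slot of a kernel `KK` on `Λ ⊕ C₀` (module 32's `hKG2` right-hand side before `* invSqrt (KK σ u)`). [cite: Balaban1988RG2Cluster, (2.14) p.15] -/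
def lOfKK {S E : Type*} (KK : S → E → Matrix (Λ ⊕ C₀) (Λ ⊕ C₀) ℂ) (σ : S) (u : E) : Matrix Λ (Λ ⊕ C₀) ℂ :=
  Matrix.fromCols (0 : Matrix Λ Λ ℂ) (KK σ u).toBlocks₁₂

/-- The two slot readings are definitional. [folklore] -/
theorem a2OfKK_eq {S E : Type*} (KK : S → E → Matrix (Λ ⊕ C₀) (Λ ⊕ C₀) ℂ) (σ : S) (u : E) :
    a2OfKK KK σ u = (KK σ u).toBlocks₁₁ ∧ lOfKK KK σ u = Matrix.fromCols (0 : Matrix Λ Λ ℂ) (KK σ u).toBlocks₁₂ := ⟨rfl, rfl⟩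

variable {E : Type}

/-- (π-Δ₀) **`Δ₀ := TC∣window` ALONG A CHART** (pin (E) of record, memo §2 (a)): the σ-free operator `u ↦ (TC n (cfg u))∣_κ` of module 32's (3″) block ∕ of the
lane's record format `Node00.ResidB13D` (field `Δ₀`, with `P Z t :=` the window, as the lane's model towers do: `Node00.CarriersB13BondTower`, `P := Λ ⊕ C₀`,
`C := 1`), for a complex chart `cfg : E → Sect2.CPair …` of the window's configurations. [cite: Balaban1988RG2Cluster, p.15 («analytic functions on the space of configurations (𝐔, 𝐉)»)] -/
def deltaOfTC {Φ : Type*} (T : Φ → ι₀ → ι₀ → ℂ) (cfg : E → Φ) (κ : q → ι₀) : E → Matrix q q ℂ :=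
  fun u => tcWindow (T (cfg u)) κ

/-- Entry of `Δ₀ := TC∣window`. [folklore] -/
@[simp] theorem deltaOfTC_apply {Φ : Type*} (T : Φ → ι₀ → ι₀ → ℂ) (cfg : E → Φ) (κ : q → ι₀) (u : E) (a b : q) :
    deltaOfTC T cfg κ u a b = T (cfg u) (κ a) (κ b) := rfl

variable [DecidableEq q]

/-- `hCle` at the lane's `C := 1` (`|1_{ab}| ≤ 1`). [folklore] -/
theorem cm_one_abs_le (a b : q) : |(1 : Matrix q q ℝ) a b| ≤ 1 := by
  rw [Matrix.one_apply]; split_ifs <;> simp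

/-- `hCsupp` at the lane's `C := 1` with `locF = locN` and any `rC ≥ 0`. [folklore] -/
theorem cm_one_supp {ν : ℕ} {Nf : Fin ν → ℕ} [∀ i, NeZero (Nf i)] (loc : q → UT Nf) {rC : ℝ} (hrC : 0 ≤ rC)
    {a b : q} (h : (1 : Matrix q q ℝ) a b ≠ 0) : tdist1 Nf (loc a) (loc b) ≤ rC := by
  by_cases hab : a = b
  · subst hab; rw [B9Thm37GlueTorus.tdist1_self]; exact hrC
  · exact absurd (Matrix.one_apply_ne hab) h

variable [Fintype q] {n₁ : ℕ}

/-- The sandwich by `(1 : Matrix q q ℝ).map (algebraMap ℝ ℂ)` is the identity. [folklore] -/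
theorem cm_one_sandwich (M : Matrix q q ℂ) :
    ((1 : Matrix q q ℝ).map (algebraMap ℝ ℂ))ᵀ * M * (1 : Matrix q q ℝ).map (algebraMap ℝ ℂ) = M := by
  rw [Matrix.map_one (algebraMap ℝ ℂ) (map_zero _) (map_one _), Matrix.transpose_one, Matrix.one_mul, Matrix.mul_one]

/-- **THE σ-DECORATED KERNEL UNDER PIN (E)** is the lane's ✓`Node00.decoratedOp Δ₀ J C` (= module 32's `hKK` right-hand side as a definition) AT `C := 1`: the bare
entrywise s-decoration `sDecorate (J ∘ Sum.elim id id) (½·raw(Δ₀) ⊕ ½·raw(Δ₀)ᵀ)` of `Δ₀ := TC∣window` — no new kernel name is introduced.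
[cite: Balaban1988RG2Cluster, (1.11) p.5, (2.5) p.12; Balaban1985BackgroundPropagators, (3.107) p.416] -/
theorem decoratedOp_cm_one (Δ₀ : E → Matrix q q ℂ) (J : q × q → Finset (TPt 4 n₁)) (σ : TPt 4 n₁ → ℂ) (u : E) :
    decoratedOp Δ₀ J (1 : Matrix q q ℝ) σ u =
      sDecorate (fun ω : (q × q) ⊕ (q × q) => J (Sum.elim id id ω))
        (fun ω u => Sum.elim (fun ω => (1 / 2 : ℂ) • rawEntryTerm Δ₀ ω u) (fun ω => (1 / 2 : ℂ) • (rawEntryTerm Δ₀ ω u)ᵀ) ω) σ u :=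
  cm_one_sandwich _

end Window

/-! ## §1b (π-C)  The averaging∕elimination operator of record (pin (F)'s names, DEF-1 ed.15c∕15e∕15g) -/

/-- (π-C) **PRINT's `C*Δ^{(k)}C` OF RECORD FACTORS THROUGH THE ELIMINATION∕AVERAGING OPERATOR `C` = ✓`recordCopLoc`** (block rows; ✓`recordCopFluct` on `FluctIdx` rows,
✓`recordCopκ` in the Gaussian carrier's rows) and the FINE precision `Δ^{(k)}` = ✓`recordSkBlk` — DEF-1's definition of ✓`recordPreckLoc`, the object (P2) pins
`TC n∣NonB0` to at the record's real points, displayed as a face so that pin (F) has its three names in one place. [cite: Balaban1987RG1, p.268 («B′ = CB», «covariance (C*Δ^{(k)}C)⁻¹»), (2.11) p.267] -/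
theorem recordPreckLoc_eq_sandwich (F : T4Family) (k K : ℕ) (εbg : ℝ) (Vk : _) (hopLin : _) :
    recordPreckLoc F k K εbg Vk hopLin = (recordCopLoc F k K Vk)ᵀ * recordSkBlk F k K εbg Vk hopLin * recordCopLoc F k K Vk := rfl

/-! ## §2  The cube-animal constant of record and the DISPLAYED rate row -/

/-- **`animRate` = memo's «`log C_anim`»**: the rate `κ₀(4·2⁴, 2·4)` of the torus geometry's (1.26) family sum at `d = 4` (= `64·log 162`). [cite: Balaban1988RG2Cluster, (1.26) p.8] -/
def animRate : ℝ := kappa₀ (4 * 2 ^ 4) (2 * 4)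

/-- **`animConst` = memo's «`C_anim`»**: the constant `K₀(4·2⁴, 2·4)` of the same family sum (`= e^{animRate}∕81`). [cite: Balaban1988RG2Cluster, (1.26) p.8] -/
def animConst : ℝ := K₀ (4 * 2 ^ 4) (2 * 4)

/-- The number: `animRate = 64·log 162` (≈ 325.6). [folklore] -/
theorem animRate_eq : animRate = 64 * Real.log 162 := TreeLengthCubeSystem.kappa₀_four

/-- `animConst = exp(animRate) ∕ (8+1)²`. [folklore] -/
theorem animConst_eq : animConst = Real.exp animRate / ((((2 * 4 : ℕ) : ℝ)) + 1) ^ 2 := rfl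

/-- `0 ≤ animRate`, `0 < animConst`. [folklore] -/
theorem animRate_nonneg_animConst_pos : 0 ≤ animRate ∧ 0 < animConst :=
  ⟨B12TreeDecay.kappa₀_nonneg (by norm_num) _, B12TreeDecay.K₀_pos _ _⟩

/-- ★ **(1.26) FOR THE RECORD's CATALOGUE `𝐃_{k+1}(T_K)`** — `Σ_{Y ∋ □} exp(−animRate·d_{k+1}(Y)) ≤ animConst` for every cube `□`, PROVED: the torus geometry's `ineq126` field
(✓`TreeLengthTorusGeometry.tgeometry`, `d = (F.P K).d = 4`) transported by `rfl`. [cite: Balaban1988RG2Cluster, (1.26) p.8] -/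
theorem ineq126_recordDomSys (F : T4Family) (Mc k K : ℕ) :
    B13FamilySum.Ineq126 (Finset.univ : Finset (recordDomSys F Mc k K).Dom) (fun X => X.1) (recordDomSys F Mc k K).dj animRate animConst :=
  (TreeLengthTorusGeometry.tgeometry (F.P K).d (Sect2.domCount (F.P K) Mc (k + 1))).ineq126

/-- ★ **THE DISPLAYED NUMBER ROW `log C_anim < δ₀`** (memo §2 (d)): def-Y's keep∕kill demand on (P4)'s rate — the entry letter's rate `entryRate δ₀ cD` is positive iff this
holds (`cD > 0`); `δ₀` is DEMANDED in `P0HolExtAtRecord`'s prefix, so the consumer instantiates it above `64·log 162`. A predicate; asserted for nothing.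
[cite: Balaban1988RG2Cluster, (1.26) p.8 («for κ sufficiently large»); Balaban1987RG1, p.263 (after (1.18))] -/
def AnimalRateRow (δ₀ : ℝ) : Prop := animRate < δ₀

/-- The porter's ENTRY RATE `ρΔ := (δ₀ − log C_anim) ∕ cD` (memo §2 (b), with the distance-comparison constant `cD` of `DistDominated`). [cite: Balaban1985BackgroundPropagators, (3.108) p.416] -/
def entryRate (δ₀ cD : ℝ) : ℝ := (δ₀ - animRate) / cD

/-- The porter's ENTRY CONSTANT `BΔ := c₀ · C_anim · e^{ρ·cS}` (memo §2 (b); the factor `e^{ρ·cS}` pays for `DistDominated`'s additive slack `cS` — print's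
`d_j(X)` is the tree length of the CUBES of `X`, zero for touching animals, and every (3.108)-type entry bound carries an `e^{O(κ)}` constant for it; still `0 ≤` from
`0 ≤ c₀`; ◆ CRIT-1 g40 (N-4)). [cite: Balaban1985BackgroundPropagators, (3.108) p.416; Balaban1987RG1, p.257 (d_j(X))] -/
def entryConst (c₀ ρ cS : ℝ) : ℝ := c₀ * animConst * Real.exp (ρ * cS)

/-- The rate row makes the entry rate positive. [folklore] -/
theorem entryRate_pos {δ₀ cD : ℝ} (h : AnimalRateRow δ₀) (hcD : 0 < cD) : 0 < entryRate δ₀ cD :=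
  div_pos (sub_pos.2 h) hcD

/-! ## §3  The two dictionary letters (memo §2 (b)): distance domination and the chart in the record space -/

variable (F : T4Family)

/-- A fluctuation index LIES IN a localization domain `Y ∈ 𝐃_{k+1}(T_K)`: its bond's source site is a site of `Y` — (P4)'s support reading, verbatim. [cite: Balaban1987RG1, (1.21) p.264] -/
def IdxInDom (Mc k K : ℕ) (i : FluctIdx F k K) (Y : (recordDomSys F Mc k K).Dom) : Prop :=
  B15DeterminingSets.embIter k i.1.src ∈ Sect2.domSites (F.P K) Mc (k + 1) Y

/-- (π-dist) **DISTANCE DOMINATION**: two window indices lying in a common `Y ∈ 𝐃_{k+1}` are within `cD · d_{k+1}(Y) + cS` for the lane's location map `loc` and site-torus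
distance `d₁` (a connected `Y ∋ b, b′` has tree length at least the cube distance of `b, b′`; `cD` converts cube units to `loc`'s units; the ADDITIVE SLACK `cS` is
mandatory: `d_{k+1}(Y) = 0` for a one-cube `Y` (`torusTreeLen_singleton`) and for every pairwise-touching `Y` (`treeLen_eq_zero_of_near`), while two distinct bonds of one
cube have `d₁ > 0` for the junction's SITE-valued `loc` — without `cS` the letter is unsatisfiable there; ◆ CRIT-1 g40 (N-4)). A predicate; asserted for nothing.
[cite: Balaban1987RG1, p.257 (d_j(X)); Balaban1984PropagatorsII, (2.46) p.231] -/
def DistDominated (Mc k K : ℕ) {q : Type} (κ : q → FluctIdx F k K) {ν : ℕ} {Nf : Fin ν → ℕ} [∀ i, NeZero (Nf i)] (loc : q → UT Nf) (cD cS : ℝ) : Prop :=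
  ∀ (Y : (recordDomSys F Mc k K).Dom) (a b : q), IdxInDom F Mc k K (κ a) Y → IdxInDom F Mc k K (κ b) Y →
    tdist1 Nf (loc a) (loc b) ≤ cD * (recordDomSys F Mc k K).dj Y + cS

/-- (R-dom) **THE CHART LANDS IN THE RECORD SPACE**: `cfg` is ℂ-differentiable on the `R`-ball and, at every point of it, the configuration lies in `U^c_{k+1}(Y, α₀, α₁)`
(`recordUc … Y`) of every `Y ∈ 𝐃_{k+1}` containing a pair of window indices (the domains whose pieces `T_Y` are seen on the window). A predicate; asserted for nothing.
[cite: Balaban1988RG2Cluster, p.15 («constants α′₀, α′₁ much bigger than α₀, α₁, therefore we can restrict them»); Balaban1987RG1, (1.18)–(1.19) p.263] -/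
def ChartInRecordSpace (Mc k : ℕ) (α₀ α₁ : ℝ) (K : ℕ) {q : Type} (κ : q → FluctIdx F k K)
    {E : Type*} [NormedAddCommGroup E] [NormedSpace ℂ E] (cfg : E → Sect2.CPair (F.P K) (MatA 2)) (R : ℝ) : Prop :=
  DifferentiableOn ℂ cfg (Metric.ball (0 : E) R) ∧
    ∀ u ∈ Metric.ball (0 : E) R, ∀ (Y : (recordDomSys F Mc k K).Dom) (a b : q), IdxInDom F Mc k K (κ a) Y → IdxInDom F Mc k K (κ b) Y →
      encodeCfg F K (cfg u) ∈ recordUc F Mc k α₀ α₁ K Y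

/-! ## §4  ★ The bridge `B`: P0's clauses at `TC` ⟹ module 32's (3″) letters at `Δ₀ := TC∣window` — ONE `Prop` -/

/-- ★ **B-decay `P0ToEntryLettersBridge`** — «(P4) Schur rows∕columns of the PIECES + (1.26) ⟹ the lane's ENTRY letters»: under the carrier clauses, the rate row and the two
dictionary letters — and the two consumer-free antecedents `McGuard F Mc` (the cube tiling partitions the torus: (1.26) is keyed on ONE cube per index, ✓`mem_domSites_iff`)
and `0 ≤ c₀` (the letter's `B_nonneg` in the empty-window corner), both held in ✓`P0HolExtAtRecord`'s prefix (★ PT-B g11 pre-cut note (N-1)(N-2)) — `Δ₀ := TC n∣window` along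
`cfg` has `RawEntryLetters` on the `R`-ball with rate `ρΔ := entryRate δ₀ cD` and constant `entryConst c₀ ρΔ cS` (memo §2 (b) with (N-4)'s slack:
`d(Y) ≥ (d₁(b,b′) − cS)∕cD ⇒ e^{−(δ₀−animRate)·d(Y)} ≤ e^{ρΔ·cS}·e^{−ρΔ·d₁(b,b′)}` by `AnimalRateRow δ₀`, hence
`‖TC_{bb′}‖ ≤ Σ_{Y ∋ b,b′} c₀e^{−δ₀d(Y)} ≤ c₀·C_anim·e^{ρΔ·cS}·e^{−ρΔ·d₁(b,b′)}`; holomorphy: finite sums of (P4)'s analytic pieces composed with the chart;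
the junction discharges the dictionary with `loc` = bond-source site, `cD ≍ M₁`, `cS ≍ 2·4·M₁` — the consumer's numbers).  A DISPLAYED STATEMENT —
its proof is a porter's file; asserted for nothing. [cite: Balaban1987RG1, (1.21) p.264, (2.11)–(2.12) pp.267–268; Balaban1988RG2Cluster, (1.26) p.8; Balaban1985BackgroundPropagators, (3.108) p.416] -/
def P0ToEntryLettersBridge (a₀ δ₀ c₀ γ₀ γ₁ : ℝ) (Mc : ℕ) (α₀ α₁ ε₂₉ : ℝ) (k : ℕ)
    (TC : (n : ℕ) → Sect2.CPair (F.P (recordK₀ F Mc k + n)) (MatA 2) →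
        FluctIdx F k (recordK₀ F Mc k + n) → FluctIdx F k (recordK₀ F Mc k + n) → ℂ)
    (TY : (n : ℕ) → (recordDomSys F Mc k (recordK₀ F Mc k + n)).Dom → Sect2.CPair (F.P (recordK₀ F Mc k + n)) (MatA 2) →
        FluctIdx F k (recordK₀ F Mc k + n) → FluctIdx F k (recordK₀ F Mc k + n) → ℂ)
    (TZY : Finset (Fin 4 → ℤ) → IntBondCfg → ((Fin 4 → ℤ) × Fin 4) × Fin 3 → ((Fin 4 → ℤ) × Fin 4) × Fin 3 → ℂ)
    (AdM : (n : ℕ) → (Site (F.P (recordK₀ F Mc k + n)) 0 → (MatA 2)ˣ) →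
        Matrix (FluctIdx F k (recordK₀ F Mc k + n)) (FluctIdx F k (recordK₀ F Mc k + n)) ℂ)
    (AdZ : ((Fin 4 → ℤ) → (MatA 2)ˣ) → (Fin 4 → ℤ) × Fin 4 → Matrix (Fin 3) (Fin 3) ℂ) : Prop :=
  McGuard F Mc → P0CarrierClauses F a₀ δ₀ c₀ γ₀ γ₁ Mc α₀ α₁ ε₂₉ k TC TY TZY AdM AdZ → AnimalRateRow δ₀ → 0 ≤ c₀ →
    ∀ (n : ℕ) {ν : ℕ} {Nf : Fin ν → ℕ} [∀ i, NeZero (Nf i)] {E : Type} [NormedAddCommGroup E] [NormedSpace ℂ E]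
      {q : Type} [Fintype q] [DecidableEq q] (κ : q → FluctIdx F k (recordK₀ F Mc k + n)) (loc : q → UT Nf)
      (cfg : E → Sect2.CPair (F.P (recordK₀ F Mc k + n)) (MatA 2)) (R cD cS : ℝ), 0 < cD → 0 ≤ cS →
      ChartInRecordSpace F Mc k α₀ α₁ (recordK₀ F Mc k + n) κ cfg R → DistDominated F Mc k (recordK₀ F Mc k + n) κ loc cD cS →
        RawEntryLetters (deltaOfTC (TC n) cfg κ) loc R (entryRate δ₀ cD) (entryConst c₀ (entryRate δ₀ cD) cS)

/-- ★ **B-acc `P0ToRefAccBridge`** — «(P5ᶜ) ⟹ the ONE reference accretivity `hKacc`»: under the carrier clauses, for a window of DISTINCT non-`b₀` indices inside a reference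
domain `Xref` whose record space contains the reference configuration `cfg 0`, a decoration whose undecorated pairs are exactly the same-component pairs, and the
conditioning letter «at the reference point the pieces leaving `Xref` vanish on the window», the lane's kernel `decoratedOp (Δ₀ := TC n∣window) J 1` at `(σ,u) = (0,0)` is
`γ₀`-accretive (memo §2 (c): at `σ = 0` only undecorated entries survive, `K(0,0) = ⊕_c ½(T + Tᵀ)∣_{comp = c}` with `T = Σ_{Y ⊆ Xref} T_Y(cfg 0)∣window`, and
`Re⟨v, ½(T+Tᵀ)v⟩ = ½Re Q(v) + ½Re Q(v̄) ≥ γ₀‖v‖²` by (P5ᶜ) at `X := Xref`).  A DISPLAYED STATEMENT — proof a porter's file; asserted for nothing.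
[cite: Balaban1988RG2Cluster, p.15 («For the pair (U′, 0) the operators are symmetric, and the measure is positive»); Balaban1985Variational, Prop. 9 p.309] -/
def P0ToRefAccBridge (a₀ δ₀ c₀ γ₀ γ₁ : ℝ) (Mc : ℕ) (α₀ α₁ ε₂₉ : ℝ) (k : ℕ)
    (TC : (n : ℕ) → Sect2.CPair (F.P (recordK₀ F Mc k + n)) (MatA 2) →
        FluctIdx F k (recordK₀ F Mc k + n) → FluctIdx F k (recordK₀ F Mc k + n) → ℂ)
    (TY : (n : ℕ) → (recordDomSys F Mc k (recordK₀ F Mc k + n)).Dom → Sect2.CPair (F.P (recordK₀ F Mc k + n)) (MatA 2) →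
        FluctIdx F k (recordK₀ F Mc k + n) → FluctIdx F k (recordK₀ F Mc k + n) → ℂ)
    (TZY : Finset (Fin 4 → ℤ) → IntBondCfg → ((Fin 4 → ℤ) × Fin 4) × Fin 3 → ((Fin 4 → ℤ) × Fin 4) × Fin 3 → ℂ)
    (AdM : (n : ℕ) → (Site (F.P (recordK₀ F Mc k + n)) 0 → (MatA 2)ˣ) →
        Matrix (FluctIdx F k (recordK₀ F Mc k + n)) (FluctIdx F k (recordK₀ F Mc k + n)) ℂ)
    (AdZ : ((Fin 4 → ℤ) → (MatA 2)ˣ) → (Fin 4 → ℤ) × Fin 4 → Matrix (Fin 3) (Fin 3) ℂ) : Prop :=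
  P0CarrierClauses F a₀ δ₀ c₀ γ₀ γ₁ Mc α₀ α₁ ε₂₉ k TC TY TZY AdM AdZ →
    ∀ (n : ℕ) {n₁ : ℕ} {E : Type} [NormedAddCommGroup E] [NormedSpace ℂ E] {q : Type} [Fintype q] [DecidableEq q]
      (κ : q → NonB0Idx F k (recordK₀ F Mc k + n)) (cfg : E → Sect2.CPair (F.P (recordK₀ F Mc k + n)) (MatA 2))
      (J : q × q → Finset (TPt 4 n₁)) (comp : q → ℕ) (Xref : (recordDomSys F Mc k (recordK₀ F Mc k + n)).Dom),
      Function.Injective κ →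
      (∀ a, IdxInDom F Mc k (recordK₀ F Mc k + n) (κ a).1 Xref) →
      encodeCfg F (recordK₀ F Mc k + n) (cfg 0) ∈ recordUc F Mc k α₀ α₁ (recordK₀ F Mc k + n) Xref →
      (∀ a b, J (a, b) = ∅ ↔ comp a = comp b) →
      (∀ (Y : (recordDomSys F Mc k (recordK₀ F Mc k + n)).Dom) (a b : q), ¬ Y.1 ⊆ Xref.1 → TY n Y (cfg 0) (κ a).1 (κ b).1 = 0) →
        ∀ v : q → ℂ, γ₀ * ∑ a, ‖v a‖ ^ 2 ≤
          (∑ a, star (v a) * (decoratedOp (deltaOfTC (TC n) cfg fun a => (κ a).1) J (1 : Matrix q q ℝ) 0 0 *ᵥ v) a).re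

/-- ★★ **THE BRIDGE `B` OF THE NODE** (memo §3, «K ∧ B ∧ F ∧ A»; letter convention (H)): «`P0CarrierClauses` at `TC` ⟹ module 32's (3″) binder block at `Δ₀ := TC∣window`» =
B-decay ∧ B-acc.  ONE `Prop`; DISPLAYED — asserted for nothing, proof a porter's file. [cite: Balaban1987RG1, (2.11)–(2.12) pp.267–268; Balaban1988RG2Cluster, (2.14) p.15] -/
def P0ToN10KernelBridge (a₀ δ₀ c₀ γ₀ γ₁ : ℝ) (Mc : ℕ) (α₀ α₁ ε₂₉ : ℝ) (k : ℕ)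
    (TC : (n : ℕ) → Sect2.CPair (F.P (recordK₀ F Mc k + n)) (MatA 2) →
        FluctIdx F k (recordK₀ F Mc k + n) → FluctIdx F k (recordK₀ F Mc k + n) → ℂ)
    (TY : (n : ℕ) → (recordDomSys F Mc k (recordK₀ F Mc k + n)).Dom → Sect2.CPair (F.P (recordK₀ F Mc k + n)) (MatA 2) →
        FluctIdx F k (recordK₀ F Mc k + n) → FluctIdx F k (recordK₀ F Mc k + n) → ℂ)
    (TZY : Finset (Fin 4 → ℤ) → IntBondCfg → ((Fin 4 → ℤ) × Fin 4) × Fin 3 → ((Fin 4 → ℤ) × Fin 4) × Fin 3 → ℂ)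
    (AdM : (n : ℕ) → (Site (F.P (recordK₀ F Mc k + n)) 0 → (MatA 2)ˣ) →
        Matrix (FluctIdx F k (recordK₀ F Mc k + n)) (FluctIdx F k (recordK₀ F Mc k + n)) ℂ)
    (AdZ : ((Fin 4 → ℤ) → (MatA 2)ˣ) → (Fin 4 → ℤ) × Fin 4 → Matrix (Fin 3) (Fin 3) ℂ) : Prop :=
  P0ToEntryLettersBridge F a₀ δ₀ c₀ γ₀ γ₁ Mc α₀ α₁ ε₂₉ k TC TY TZY AdM AdZ ∧
    P0ToRefAccBridge F a₀ δ₀ c₀ γ₀ γ₁ Mc α₀ α₁ ε₂₉ k TC TY TZY AdM AdZ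

/-- The bridge unpacks into its two halves. [folklore] -/
theorem p0ToN10KernelBridge_iff (a₀ δ₀ c₀ γ₀ γ₁ : ℝ) (Mc : ℕ) (α₀ α₁ ε₂₉ : ℝ) (k : ℕ)
    (TC : (n : ℕ) → Sect2.CPair (F.P (recordK₀ F Mc k + n)) (MatA 2) →
        FluctIdx F k (recordK₀ F Mc k + n) → FluctIdx F k (recordK₀ F Mc k + n) → ℂ)
    (TY : (n : ℕ) → (recordDomSys F Mc k (recordK₀ F Mc k + n)).Dom → Sect2.CPair (F.P (recordK₀ F Mc k + n)) (MatA 2) →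
        FluctIdx F k (recordK₀ F Mc k + n) → FluctIdx F k (recordK₀ F Mc k + n) → ℂ)
    (TZY : Finset (Fin 4 → ℤ) → IntBondCfg → ((Fin 4 → ℤ) × Fin 4) × Fin 3 → ((Fin 4 → ℤ) × Fin 4) × Fin 3 → ℂ)
    (AdM : (n : ℕ) → (Site (F.P (recordK₀ F Mc k + n)) 0 → (MatA 2)ˣ) →
        Matrix (FluctIdx F k (recordK₀ F Mc k + n)) (FluctIdx F k (recordK₀ F Mc k + n)) ℂ)
    (AdZ : ((Fin 4 → ℤ) → (MatA 2)ˣ) → (Fin 4 → ℤ) × Fin 4 → Matrix (Fin 3) (Fin 3) ℂ) :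
    P0ToN10KernelBridge F a₀ δ₀ c₀ γ₀ γ₁ Mc α₀ α₁ ε₂₉ k TC TY TZY AdM AdZ ↔
      P0ToEntryLettersBridge F a₀ δ₀ c₀ γ₀ γ₁ Mc α₀ α₁ ε₂₉ k TC TY TZY AdM AdZ ∧
        P0ToRefAccBridge F a₀ δ₀ c₀ γ₀ γ₁ Mc α₀ α₁ ε₂₉ k TC TY TZY AdM AdZ := Iff.rfl

end Summit.QuantumFields.YangMills.Theorems.K0P0CarrierPins

end
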